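import Summits.ResolutionOfSingularities.ResolutionOfSingularities.Theorems.MonomialTowerClasses
import HarnessLib

/-!
# CornerTowerDynamicsTwo — the two-letter Euclid dynamics on `ℤ²` (pure integers)
(decomp-res node «ProximityCut» rev 3, lens-3 g12, sha256 e1d6297007058045; CRITIC-LEDGER row 84 CLEARED-REV3,
filing order (W5);
co-credit lens-5 g13 `Theorems/CornerTowerDescent`, row 82)

[WRITER NOTE (decomp-res writer g5).  W5 of critic row 84 is filed as three modules sharing the namespace
`…Theorems.CornerTowerDynamics` (tree convention: files ≤ 400 lines): THIS file = lens §6 (ii) `dyn_exit` /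
`dyn_absorb` / `dyn_eventually` (:986–:1086) VERBATIM; `CornerTowerDynamicsThree` = lens §6b (three letters);
`CornerTowerDynamics` = lens §7 (the tree leaf `NoCornerTower 4 n` and `HugDimensionClasses.NoCornerTowers` BY NAME).
The lens namespace `…Theorems.ProximityCut` and its §1–§6 E-model material (forced walks, `NoOriginTails`, …) are filed
separately as `Theorems/ProximityCutClasses` (W6), importing these.  0 sorry, no definitions.]

THE DYNAMICS.  `L : (x,y) ↦ (x+y, y)`, `R : (x,y) ↦ (x, x+y)` on `ℤ²`, the letter at time `n` chosen by a predicate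
`L n`; hypotheses: the orbit is never doubly negative and both letters recur.  CONCLUSION: the absorbing quadrant
`x, y ≥ 0` is entered (`dyn_exit`: while `x < 0` one has `y > 0` — a zero `y` would be frozen through `L`-steps and make
the next `R`-step doubly negative — and `y − x` drops at every step; `dyn_absorb`; `dyn_eventually`, the symmetric exit
by the swap `x ↔ y`, `L ↔ R`).  Consumers: `CornerTowerDynamics.CornerTowerDyn.lineage_fat` (corner towers, two
recurring live directions) and the E-model origin cut of `ProximityCutClasses`. (Sources: Hauser2010 Lecture IX;
BierstoneGrigorievMilmanWlodarczyk2011, §3.)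
-/

namespace Summit.ResolutionOfSingularities.ResolutionOfSingularities.Theorems.CornerTowerDynamics

/-- **(ii) EUCLID DYNAMICS EXIT (PROVED, pure integers).**  `L : (x,y) ↦ (x+y,y)`, `R : (x,y) ↦ (x,x+y)`, never
doubly negative, `R` recurring: from `x < 0` the quadrant `x, y ≥ 0` is reached (`y > 0` throughout, `y − x`
drops). [folklore] -/
theorem dyn_exit (x y : ℕ → ℤ) (L : ℕ → Prop) (hL : ∀ n, L n → x (n + 1) = x n + y n ∧ y (n + 1) = y n)
    (hR : ∀ n, ¬ L n → x (n + 1) = x n ∧ y (n + 1) = x n + y n) (hH : ∀ n, ¬ (x n < 0 ∧ y n < 0))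
    (hRio : ∀ n, ∃ m, n ≤ m ∧ ¬ L m) :
    ∀ (μ : ℕ) (n : ℕ), x n < 0 → y n - x n ≤ μ → ∃ n', 0 ≤ x n' ∧ 0 ≤ y n' := by
  classical
  -- while `x < 0`, `y > 0`: a zero `y` is frozen through `L`-steps and the next `R`-step is doubly negative
  have hpos : ∀ n, x n < 0 → 0 < y n := by
    intro n hx
    by_contra hy
    push Not at hy
    rcases lt_or_eq_of_le hy with hy | hy
    · exact hH n ⟨hx, hy⟩
    · let m := Nat.find (hRio n)
      have hm : n ≤ m ∧ ¬ L m := Nat.find_spec (hRio n)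
      have hmin : ∀ m', m' < m → ¬ (n ≤ m' ∧ ¬ L m') := fun m' hm' => Nat.find_min (hRio n) hm'
      have frozen : ∀ m', n ≤ m' → m' ≤ m → x m' = x n ∧ y m' = 0 := by
        intro m' hm'
        induction m', hm' using Nat.le_induction with
        | base => exact fun _ => ⟨rfl, hy⟩
        | succ m' hm' ih =>
          intro hle
          obtain ⟨ex, ey⟩ := ih (by omega)
          have hLm' : L m' := by
            by_contra hc
            exact hmin m' (by omega) ⟨hm', hc⟩
          obtain ⟨ex', ey'⟩ := hL m' hLm'
          refine ⟨?_, ?_⟩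
          · rw [ex', ex, ey, add_zero]
          · rw [ey', ey]
      obtain ⟨ex, ey⟩ := frozen m hm.1 le_rfl
      obtain ⟨ex', ey'⟩ := hR m hm.2
      refine hH (m + 1) ⟨?_, ?_⟩
      · rw [ex', ex]; exact hx
      · rw [ey', ex, ey, add_zero]; exact hx
  intro μ
  induction μ with
  | zero =>
    intro n hx hμ
    have := hpos n hx
    push_cast at hμ
    omega
  | succ μ ih =>
    intro n hx hμ
    have hy := hpos n hx
    push_cast at hμ
    by_cases hl : L n
    · obtain ⟨ex, ey⟩ := hL n hl
      by_cases hx' : 0 ≤ x (n + 1)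
      · exact ⟨n + 1, hx', by rw [ey]; omega⟩
      · push Not at hx'
        exact ih (n + 1) hx' (by rw [ex, ey]; omega)
    · obtain ⟨ex, ey⟩ := hR n hl
      have hx1 : x (n + 1) < 0 := by rw [ex]; exact hx
      have hy1 : 0 ≤ y (n + 1) := by
        by_contra hc
        push Not at hc
        exact hH (n + 1) ⟨hx1, hc⟩
      exact ih (n + 1) hx1 (by rw [ex, ey]; omega)

/-- The quadrant `x, y ≥ 0` is absorbing. [folklore] -/
theorem dyn_absorb (x y : ℕ → ℤ) (L : ℕ → Prop) (hL : ∀ n, L n → x (n + 1) = x n + y n ∧ y (n + 1) = y n)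
    (hR : ∀ n, ¬ L n → x (n + 1) = x n ∧ y (n + 1) = x n + y n) {n : ℕ} (hx : 0 ≤ x n) (hy : 0 ≤ y n) :
    ∀ m, n ≤ m → 0 ≤ x m ∧ 0 ≤ y m := by
  classical
  intro m hm
  induction m, hm using Nat.le_induction with
  | base => exact ⟨hx, hy⟩
  | succ m hm ih =>
    obtain ⟨ex, ey⟩ := ih
    by_cases hl : L m
    · obtain ⟨e1, e2⟩ := hL m hl
      rw [e1, e2]
      exact ⟨add_nonneg ex ey, ey⟩
    · obtain ⟨e1, e2⟩ := hR m hl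
      rw [e1, e2]
      exact ⟨ex, add_nonneg ex ey⟩

/-- **EUCLID DYNAMICS (PROVED):** never doubly negative + both letters recurring ⇒ eventually in the quadrant. [folklore] -/
theorem dyn_eventually (x y : ℕ → ℤ) (L : ℕ → Prop) (hL : ∀ n, L n → x (n + 1) = x n + y n ∧ y (n + 1) = y n)
    (hR : ∀ n, ¬ L n → x (n + 1) = x n ∧ y (n + 1) = x n + y n) (hH : ∀ n, ¬ (x n < 0 ∧ y n < 0))
    (hLio : ∀ n, ∃ m, n ≤ m ∧ L m) (hRio : ∀ n, ∃ m, n ≤ m ∧ ¬ L m) :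
    ∃ n₀, ∀ n, n₀ ≤ n → 0 ≤ x n ∧ 0 ≤ y n := by
  classical
  by_cases hx : 0 ≤ x 0
  · by_cases hy : 0 ≤ y 0
    · exact ⟨0, dyn_absorb x y L hL hR hx hy⟩
    · push Not at hy
      -- symmetric exit: swap `x ↔ y`, `L ↔ R`
      obtain ⟨n', hy', hx'⟩ := dyn_exit y x (fun n => ¬ L n)
        (fun n hn => ⟨by rw [(hR n hn).2, add_comm], (hR n hn).1⟩)
        (fun n hn => ⟨(hL n (not_not.mp hn)).2, by rw [(hL n (not_not.mp hn)).1, add_comm]⟩)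
        (fun n hc => hH n ⟨hc.2, hc.1⟩) (fun n => by
          obtain ⟨m, hm, hLm⟩ := hLio n
          exact ⟨m, hm, not_not.mpr hLm⟩)
        ((x 0 - y 0).toNat) 0 hy (Int.self_le_toNat _)
      exact ⟨n', dyn_absorb x y L hL hR hx' hy'⟩
  · push Not at hx
    obtain ⟨n', hx', hy'⟩ := dyn_exit x y L hL hR hH hRio ((y 0 - x 0).toNat) 0 hx (Int.self_le_toNat _)
    exact ⟨n', dyn_absorb x y L hL hR hx' hy'⟩

end Summit.ResolutionOfSingularities.ResolutionOfSingularities.Theorems.CornerTowerDynamics
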